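import Literature.NumberTheory.LFunctions.Zhang2022.Section8ProfileSjPointwise
import HarnessLib

/-!
# Zhang (2022) §8 p. 47: the RANGE SUMS of the gathering for profile data — the «simple approximation» over `n = dr`:
# the good range `n < P^θ/T²` costs `≪ Λ⁻²·ERR·(1 + log P^θ)` and the sliver `P^θ/T² ≤ n < P^θ` costs
# `≪ B₁²τ₁²(1+τ₁Λ)Ξ·(1 + 2𝓛^{1.1})`, both through the multiplicative weight bound `Σ_{dr=n}|w_j|(1+|Π|)rel² ≤ 2n⁻¹∏(1+430/q)`

Topic `Literature/NumberTheory/LFunctions/Zhang2022` (Landau–Siegel audit tree; verdict-neutral). Y. Zhang, *Discrete mean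
estimates and the Landau–Siegel zero*, arXiv:2211.02515v1 (2022) [Zhang2022LandauSiegel] — **an unrefereed manuscript
under adjudication; nothing here asserts or denies its Theorems 1–2; no claim about Landau–Siegel zeros.** Cell
landau-siegel §D, crux K0 = stmt-Parity-20459 (row (S)), prover ls-knife-K0-p1 g2. Profile-data twin of
`Section8FrontEnd44ReductionRel.range_sum_le_rel` + `coreRel` (Zhang's data): at a FIXED modulus, with the analytic inputs
displayed as hypotheses (the Lemma-8.4 content `h84` for every `(d,r)` of the good range; a bound `Ξ` for the absolute
logarithmic means of `ξ₀ⱼ`),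

* `psiMain`, `antiMain` — the two main terms `A_j(n) = −χ(n)Λ⁻¹L′·jetEx(z_n)`, `B_j(d,r) = χ(n)Λ⁻¹L′Π(d,r)·massEx(z_n)`;
  `errGood` — the uniform constant `ERR = δM₀(|L′|K₀ + δN₀) + |L′|J₀δN₀` of `pointwise_good`;
* `norm_sum_sum_sjWeight_mul_le` — the weighted range sum (wrapper of `range_sum_le_rel`);
* `good_term_le`, `good_range_bound` — `‖ΣΣ_{n<Y} w(MN − AB)‖ ≤ 2e⁴³⁰Λ⁻²ERR(1 + log Y)`;
* `sliver_term_le`, `sliver_range_bound` — `‖ΣΣ_{Y≤n<P^θ} wMN‖ ≤ 2e⁴³⁰B₁²τ₁²(1+τ₁Λ)Ξ(1 + log(P^θ/Y))`.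

## References
* Y. Zhang, arXiv:2211.02515v1 (2022), §8 display before (8.10), p. 47 («by simple approximation»).
  [cite: Zhang2022LandauSiegel, §8 p.47]
-/

noncomputable section

open Complex Real Finset MeasureTheory Set intervalIntegral
open scoped ComplexConjugate

namespace Literature.NumberTheory.LFunctions.Zhang2022.DipoleRule

open Skeleton KnifeEdge

/-! ### The main terms and the uniform error constant -/

/-- **The ψ-side main term `A_j(n) = −χ(n)Λ⁻¹L′(1,χ)·(β_jΛu + u′)(z_n)`**, `z_n = log n/Λ`.
[cite: Zhang2022LandauSiegel, §8 display after Lemma 8.4, p.47] -/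
def psiMain (c' : ℝ) (D : ℕ) [NeZero D] (χ : DirichletCharacter ℂ D) (j : ℕ) (u u' : ℝ → ℂ) (n : ℕ) : ℂ :=
  -(χ (n : ZMod D) * ((Real.log D ^ 9 : ℝ) : ℂ)⁻¹ * deriv χ.LFunction 1 *
      jetEx (betaJ c' D j * Real.log D ^ 9) u u' (Real.log n / Real.log D ^ 9))

/-- **The anti-side main term `B_j(d,r) = χ(dr)Λ⁻¹L′(1,χ)Π(d,r)·massEx(σ_j,ν_j)(z_{dr})`**.
[cite: Zhang2022LandauSiegel, §8 display after Lemma 8.4, p.47] -/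
def antiMain (c' : ℝ) (D : ℕ) [NeZero D] (χ : DirichletCharacter ℂ D) (j : ℕ) (u u' : ℝ → ℂ) (θ : ℝ) (p : ℕ × ℕ) : ℂ :=
  χ ((p.1 * p.2 : ℕ) : ZMod D) * ((Real.log D ^ 9 : ℝ) : ℂ)⁻¹ * deriv χ.LFunction 1 * PiW χ p.1 p.2 *
    massEx (sigmaJ c' D j) (nuJ c' D j) θ u u' (Real.log ((p.1 * p.2 : ℕ) : ℝ) / Real.log D ^ 9)

/-- **`ERR`** — the uniform constant of the good range: `δM₀(L′K₀ + δN₀) + L′J₀δN₀`.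
[cite: Zhang2022LandauSiegel, §8 p.47] -/
def errGood (c' : ℝ) (D : ℕ) (j : ℕ) (B₀ B₁ B₂ C₈₄ Ξ L' θ : ℝ) : ℝ :=
  deltaM0 c' D j B₀ B₁ B₂ L' * (L' * antiK0 c' D j B₀ B₁ θ + deltaN0 c' D j B₀ B₁ B₂ C₈₄ Ξ L')
    + L' * psiJ0 c' D j B₀ B₁ * deltaN0 c' D j B₀ B₁ B₂ C₈₄ Ξ L'

/-! ### The weighted range sum -/

/-- **The weighted range sum:** if `‖Φ(d,r)‖ ≤ E·(∏_{q∣n}(1−q⁻¹)⁻¹)²(1 + |Π(d,r)|)` for `dr = n ∈ [⌈Y⌉, ⌈Z⌉)`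
(`1 ≤ Y ≤ Z`, `E ≥ 0`), then `‖Σ_n Σ_{dr=n} w_j(d,r)Φ(d,r)‖ ≤ 2e⁴³⁰E(1 + log(Z/Y))`
(`Section8FrontEnd44ReductionRel.range_sum_le_rel`). [cite: Zhang2022LandauSiegel, §8 p.47] -/
theorem norm_sum_sum_sjWeight_mul_le (c' : ℝ) {D : ℕ} [NeZero D] (χ : DirichletCharacter ℂ D) (j : ℕ)
    {Y Z E : ℝ} (hY : 1 ≤ Y) (hYZ : Y ≤ Z) (hE : 0 ≤ E) (Φ : ℕ × ℕ → ℂ)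
    (hΦ : ∀ n ∈ Finset.Ico ⌈Y⌉₊ ⌈Z⌉₊, ∀ p ∈ Nat.divisorsAntidiagonal n,
      ‖Φ p‖ ≤ E * ((∏ q ∈ n.primeFactors, (1 - (q : ℝ)⁻¹)⁻¹) ^ 2 * (1 + ‖PiW χ p.1 p.2‖))) :
    ‖∑ n ∈ Finset.Ico ⌈Y⌉₊ ⌈Z⌉₊, ∑ p ∈ Nat.divisorsAntidiagonal n, sjWeight c' χ j p * Φ p‖
      ≤ 2 * Real.exp 430 * E * (1 + Real.log (Z / Y)) := by
  have h := Section8FrontEnd44ReductionRel.range_sum_le_rel c' χ j hY hYZ hE Φ hΦ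
  calc ‖∑ n ∈ Finset.Ico ⌈Y⌉₊ ⌈Z⌉₊, ∑ p ∈ Nat.divisorsAntidiagonal n, sjWeight c' χ j p * Φ p‖
      ≤ ∑ n ∈ Finset.Ico ⌈Y⌉₊ ⌈Z⌉₊, ‖∑ p ∈ Nat.divisorsAntidiagonal n, sjWeight c' χ j p * Φ p‖ := norm_sum_le _ _
    _ ≤ ∑ n ∈ Finset.Ico ⌈Y⌉₊ ⌈Z⌉₊, ∑ p ∈ Nat.divisorsAntidiagonal n, ‖sjWeight c' χ j p‖ * ‖Φ p‖ := by
        refine Finset.sum_le_sum fun n _ => (norm_sum_le _ _).trans (le_of_eq ?_)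
        exact Finset.sum_congr rfl fun p _ => norm_mul _ _
    _ ≤ 2 * Real.exp 430 * E * (1 + Real.log (Z / Y)) := h

/-! ### The sliver `P^θ/T² ≤ n < P^θ` -/

/-- **Sliver term:** for `dr = n` with `e^{(θ−τ₁)Λ} ≤ n ≤ e^{θΛ}` (`τ₁ = 2L₁/Λ`), a short piece with `‖u(z)‖ ≤ B₁(θ − z)`
on `[0,θ]` and a bound `Ξ` for `Σ_{m<⌈y⌉}‖ξ₀ⱼ(m;d,r)‖/m`, `1 ≤ y ≤ e^{τ₁Λ}`:
`‖M_j(n)·N_j(d,r)‖ ≤ B₁²τ₁²(1 + τ₁Λ)Ξ`. [cite: Zhang2022LandauSiegel, §8 p.47] -/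
theorem sliver_term_le {D : ℕ} (χ : DirichletCharacter ℂ D) (hq : χ.IsQuadratic) (c' : ℝ) (j : ℕ)
    {u : ℝ → ℂ} {θ B₁ Ξ : ℝ} (hvan : ∀ y : ℝ, θ ≤ y → u y = 0) (hB : ∀ z ∈ Icc 0 θ, ‖u z‖ ≤ B₁ * (θ - z))
    (hB1 : 0 ≤ B₁) (hℓ : 0 < Real.log D) (hθN : Real.exp (θ * Real.log D ^ 9) < Nsupp D) {d r : ℕ}
    (hd : 1 ≤ d) (hr : 1 ≤ r)
    (hnY : Real.exp ((θ - 2 * Real.log D ^ (11 / 10 : ℝ) / Real.log D ^ 9) * Real.log D ^ 9) ≤ ((d * r : ℕ) : ℝ))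
    (hnθ : ((d * r : ℕ) : ℝ) ≤ Real.exp (θ * Real.log D ^ 9))
    (hΞ : ∀ y : ℝ, 1 ≤ y → y ≤ Real.exp (2 * Real.log D ^ (11 / 10 : ℝ) / Real.log D ^ 9 * Real.log D ^ 9) →
      ∑ m ∈ Finset.Ico 1 ⌈y⌉₊, ‖xiZero c' D j m d r‖ / m ≤ Ξ) :
    ‖psiSum c' D χ j u (d * r) * antiSum c' D χ j u d r‖
      ≤ B₁ ^ 2 * (2 * Real.log D ^ (11 / 10 : ℝ) / Real.log D ^ 9) ^ 2
          * (1 + 2 * Real.log D ^ (11 / 10 : ℝ) / Real.log D ^ 9 * Real.log D ^ 9) * Ξ := by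
  set Λ : ℝ := Real.log D ^ 9 with hΛ
  set τ₁ : ℝ := 2 * Real.log D ^ (11 / 10 : ℝ) / Λ with hτ₁
  set t : ℕ := d * r with htdef
  set Z : ℝ := θ - Real.log (t : ℝ) / Λ with hZ
  have hΛ0 : 0 < Λ := by positivity
  have hτ0 : 0 < τ₁ := by
    have : 0 < Real.log D ^ (11 / 10 : ℝ) := Real.rpow_pos_of_pos hℓ _
    positivity
  have ht : 1 ≤ t := Nat.one_le_iff_ne_zero.mpr (Nat.mul_ne_zero (by omega) (by omega))
  have ht0 : (0 : ℝ) < t := by exact_mod_cast ht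
  -- `0 ≤ Z ≤ τ₁`
  have hZ0 : 0 ≤ Z := by
    have : Real.log (t : ℝ) ≤ θ * Λ := by rw [← Real.log_exp (θ * Λ)]; exact Real.log_le_log ht0 hnθ
    have : Real.log (t : ℝ) / Λ ≤ θ := by rw [div_le_iff₀ hΛ0]; exact this
    linarith
  have hZτ : Z ≤ τ₁ := by
    have : (θ - τ₁) * Λ ≤ Real.log (t : ℝ) := by
      rw [← Real.log_exp ((θ - τ₁) * Λ)]; exact Real.log_le_log (Real.exp_pos _) hnY
    have : θ - τ₁ ≤ Real.log (t : ℝ) / Λ := by rw [le_div_iff₀ hΛ0]; exact this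
    linarith
  -- the two crude bounds
  have hM := norm_psiSum_le_crude χ c' j hvan hB hB1 hℓ ht hnθ hθN
  have hN := norm_antiSum_le_crude χ hq c' j d r hvan hB hB1 hℓ ht hnθ hθN
  have hM' : ‖psiSum c' D χ j u t‖ ≤ B₁ * τ₁ * (1 + τ₁ * Λ) := by
    refine hM.trans ?_
    change B₁ * Z * (1 + Z * Λ) ≤ B₁ * τ₁ * (1 + τ₁ * Λ)
    gcongr
  have hy1 : 1 ≤ Real.exp (Z * Λ) := Real.one_le_exp (mul_nonneg hZ0 hΛ0.le)
  have hyτ : Real.exp (Z * Λ) ≤ Real.exp (τ₁ * Λ) := Real.exp_le_exp.mpr (mul_le_mul_of_nonneg_right hZτ hΛ0.le)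
  have hΞ' := hΞ _ hy1 hyτ
  have hΞ0 : 0 ≤ Ξ := le_trans (Finset.sum_nonneg fun m _ => by positivity) hΞ'
  have hN' : ‖antiSum c' D χ j u d r‖ ≤ B₁ * τ₁ * Ξ := by
    refine hN.trans ?_
    change B₁ * Z * ∑ m ∈ Finset.Ico 1 ⌈Real.exp (Z * Λ)⌉₊, ‖xiZero c' D j m d r‖ / m ≤ B₁ * τ₁ * Ξ
    have h1 : B₁ * Z * ∑ m ∈ Finset.Ico 1 ⌈Real.exp (Z * Λ)⌉₊, ‖xiZero c' D j m d r‖ / m ≤ B₁ * Z * Ξ :=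
      mul_le_mul_of_nonneg_left hΞ' (mul_nonneg hB1 hZ0)
    refine h1.trans ?_
    gcongr
  rw [norm_mul]
  calc ‖psiSum c' D χ j u t‖ * ‖antiSum c' D χ j u d r‖
      ≤ (B₁ * τ₁ * (1 + τ₁ * Λ)) * (B₁ * τ₁ * Ξ) :=
        mul_le_mul hM' hN' (norm_nonneg _) (by positivity)
    _ = B₁ ^ 2 * τ₁ ^ 2 * (1 + τ₁ * Λ) * Ξ := by ring

/-- **THE SLIVER RANGE:** with `Y = e^{(θ−τ₁)Λ}` (`1 ≤ Y`) and the hypotheses of `sliver_term_le` for every `(d,r)` of the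
range, `‖Σ_{⌈Y⌉≤n<⌈e^{θΛ}⌉} Σ_{dr=n} w_j(d,r)M_j(n)N_j(d,r)‖ ≤ 2e⁴³⁰·B₁²τ₁²(1+τ₁Λ)Ξ·(1 + log(e^{θΛ}/Y))`.
[cite: Zhang2022LandauSiegel, §8 p.47] -/
theorem sliver_range_bound (c' : ℝ) {D : ℕ} [NeZero D] (χ : DirichletCharacter ℂ D) (hq : χ.IsQuadratic) (j : ℕ)
    {u : ℝ → ℂ} {θ B₁ Ξ : ℝ} (hvan : ∀ y : ℝ, θ ≤ y → u y = 0) (hB : ∀ z ∈ Icc 0 θ, ‖u z‖ ≤ B₁ * (θ - z))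
    (hB1 : 0 ≤ B₁) (hℓ : 0 < Real.log D) (hθN : Real.exp (θ * Real.log D ^ 9) < Nsupp D)
    (hY1 : 1 ≤ Real.exp ((θ - 2 * Real.log D ^ (11 / 10 : ℝ) / Real.log D ^ 9) * Real.log D ^ 9))
    (hΞ : ∀ d r : ℕ, 1 ≤ d → 1 ≤ r → ((d * r : ℕ) : ℝ) ≤ Real.exp (θ * Real.log D ^ 9) →
      ∀ y : ℝ, 1 ≤ y → y ≤ Real.exp (2 * Real.log D ^ (11 / 10 : ℝ) / Real.log D ^ 9 * Real.log D ^ 9) →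
        ∑ m ∈ Finset.Ico 1 ⌈y⌉₊, ‖xiZero c' D j m d r‖ / m ≤ Ξ) :
    ‖∑ n ∈ Finset.Ico ⌈Real.exp ((θ - 2 * Real.log D ^ (11 / 10 : ℝ) / Real.log D ^ 9) * Real.log D ^ 9)⌉₊
        ⌈Real.exp (θ * Real.log D ^ 9)⌉₊,
        ∑ p ∈ Nat.divisorsAntidiagonal n, sjWeight c' χ j p * (psiSum c' D χ j u n * antiSum c' D χ j u p.1 p.2)‖
      ≤ 2 * Real.exp 430 *
          (B₁ ^ 2 * (2 * Real.log D ^ (11 / 10 : ℝ) / Real.log D ^ 9) ^ 2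
            * (1 + 2 * Real.log D ^ (11 / 10 : ℝ) / Real.log D ^ 9 * Real.log D ^ 9) * Ξ)
          * (1 + Real.log (Real.exp (θ * Real.log D ^ 9)
              / Real.exp ((θ - 2 * Real.log D ^ (11 / 10 : ℝ) / Real.log D ^ 9) * Real.log D ^ 9))) := by
  set Y : ℝ := Real.exp ((θ - 2 * Real.log D ^ (11 / 10 : ℝ) / Real.log D ^ 9) * Real.log D ^ 9) with hY
  set X : ℝ := Real.exp (θ * Real.log D ^ 9) with hX
  have hτ0 : 0 ≤ 2 * Real.log D ^ (11 / 10 : ℝ) / Real.log D ^ 9 := by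
    have : 0 < Real.log D ^ (11 / 10 : ℝ) := Real.rpow_pos_of_pos hℓ _
    positivity
  have hYX : Y ≤ X := by
    rw [hY, hX, Real.exp_le_exp]
    have h9 : 0 < Real.log D ^ 9 := by positivity
    nlinarith
  -- `Ξ ≥ 0` (from the hypothesis at `d = r = 1`, if the range is nonempty we do not even need it; prove it anyway)
  have hE : 0 ≤ B₁ ^ 2 * (2 * Real.log D ^ (11 / 10 : ℝ) / Real.log D ^ 9) ^ 2
      * (1 + 2 * Real.log D ^ (11 / 10 : ℝ) / Real.log D ^ 9 * Real.log D ^ 9) * Ξ := by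
    have hX1 : ((1 * 1 : ℕ) : ℝ) ≤ X := by
      have : Y ≤ X := hYX
      push_cast; linarith
    have hΞ0 : 0 ≤ Ξ := le_trans (Finset.sum_nonneg fun m _ => by positivity)
      (hΞ 1 1 le_rfl le_rfl hX1 1 le_rfl (Real.one_le_exp (by
        have h9 : 0 < Real.log D ^ 9 := by positivity
        positivity)))
    positivity
  have key := norm_sum_sum_sjWeight_mul_le c' χ j hY1 hYX hE
    (fun p => psiSum c' D χ j u (p.1 * p.2) * antiSum c' D χ j u p.1 p.2) ?_
  · -- re-index `psiSum n = psiSum (p.1 * p.2)` on the antidiagonal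
    have hre : (∑ n ∈ Finset.Ico ⌈Y⌉₊ ⌈X⌉₊, ∑ p ∈ Nat.divisorsAntidiagonal n,
          sjWeight c' χ j p * (psiSum c' D χ j u n * antiSum c' D χ j u p.1 p.2))
        = ∑ n ∈ Finset.Ico ⌈Y⌉₊ ⌈X⌉₊, ∑ p ∈ Nat.divisorsAntidiagonal n,
          sjWeight c' χ j p * (psiSum c' D χ j u (p.1 * p.2) * antiSum c' D χ j u p.1 p.2) := by
      refine Finset.sum_congr rfl fun n _ => Finset.sum_congr rfl fun p hp => ?_
      rw [Nat.mem_divisorsAntidiagonal] at hp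
      rw [hp.1]
    rw [hre]
    exact key
  · rintro n hn ⟨d, r⟩ hp
    rw [Finset.mem_Ico] at hn
    rw [Nat.mem_divisorsAntidiagonal] at hp
    obtain ⟨hpn, hn0⟩ := hp
    subst hpn
    have hp1 : 1 ≤ d := Nat.one_le_iff_ne_zero.mpr fun h => hn0 (by rw [h, zero_mul])
    have hp2 : 1 ≤ r := Nat.one_le_iff_ne_zero.mpr fun h => hn0 (by rw [h, mul_zero])
    have hnY' : Y ≤ ((d * r : ℕ) : ℝ) := (Nat.le_ceil Y).trans (by exact_mod_cast hn.1)
    have hnX : ((d * r : ℕ) : ℝ) ≤ X := (Nat.lt_ceil.mp hn.2).le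
    have hrel1 : 1 ≤ (∏ q ∈ (d * r).primeFactors, (1 - (q : ℝ)⁻¹)⁻¹) ^ 2 :=
      Section8FrontEnd44ReductionRel.one_le_relFac (d * r)
    have hPi0 : 0 ≤ ‖PiW χ d r‖ := norm_nonneg _
    have h := sliver_term_le χ hq c' j hvan hB hB1 hℓ hθN hp1 hp2 hnY' hnX (hΞ d r hp1 hp2 hnX)
    refine h.trans ?_
    have hR : 1 ≤ (∏ q ∈ (d * r).primeFactors, (1 - (q : ℝ)⁻¹)⁻¹) ^ 2 * (1 + ‖PiW χ d r‖) :=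
      one_le_mul_of_one_le_of_one_le hrel1 (by linarith)
    exact le_mul_of_one_le_right hE hR

/-! ### The good range `n < P^θ/T²` -/

/-- **Good term:** at `dr = n < e^{(θ−τ₁)Λ}` the two rows apply (`τ₁ ≤ Z_n`), and `pointwise_good` gives
`‖M_j(n)N_j(d,r) − A_j(n)B_j(d,r)‖ ≤ Λ⁻²·(∏_{q∣n}(1−q⁻¹)⁻¹)²(1+|Π(d,r)|)·ERR` with `ERR = errGood` at `L′ = ‖L′(1,χ)‖`.
[cite: Zhang2022LandauSiegel, §8 Lemmas 8.2–8.4 and display before (8.10), p.47] -/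
theorem good_term_le {D : ℕ} [NeZero D] (χ : DirichletCharacter ℂ D) (hq : χ.IsQuadratic) (hprim : χ.IsPrimitive)
    (c' : ℝ) (j : ℕ) (hL : 3 ≤ Real.log D) (hA : ‖χ.LFunction 1‖ ≤ 1 / Real.log D ^ 2022)
    {u u' u'' : ℝ → ℂ} {θ : ℝ} (hθ0 : 0 ≤ θ) (hθ1 : θ < 1)
    (hu : ContinuousOn u (Icc 0 θ)) (hu' : ContinuousOn u' (Icc 0 θ)) (hu'' : ContinuousOn u'' (Icc 0 θ))
    (hd : ∀ y ∈ Ioo 0 θ, HasDerivWithinAt u (u' y) (Ioi y) y)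
    (hd' : ∀ y ∈ Ioo 0 θ, HasDerivWithinAt u' (u'' y) (Ioi y) y) (hvan : ∀ y : ℝ, θ ≤ y → u y = 0)
    {B₀ B₁ B₂ : ℝ} (hB00 : 0 ≤ B₀) (hB10 : 0 ≤ B₁) (hB20 : 0 ≤ B₂)
    (hB0 : ∀ y ∈ Icc 0 θ, ‖u y‖ ≤ B₀) (hB1 : ∀ y ∈ Icc 0 θ, ‖u' y‖ ≤ B₁)
    (hB2 : ∀ y ∈ Icc 0 θ, ‖u'' y‖ ≤ B₂) (hθN : Real.exp (θ * Real.log D ^ 9) < Nsupp D)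
    {d r : ℕ} (hd1 : 1 ≤ d) (hr1 : 1 ≤ r)
    (hnY : ((d * r : ℕ) : ℝ) ≤ Real.exp ((θ - 2 * Real.log D ^ (11 / 10 : ℝ) / Real.log D ^ 9) * Real.log D ^ 9))
    {C₈₄ Ξ : ℝ}
    (h84 : ∀ y : ℝ, bigT D < y → y < bigP D →
      ‖(∑ n ∈ Finset.Ico 1 ⌈y⌉₊, χ (n : ZMod D) * xiZero c' D j n d r / (n : ℂ) *
            ((y / n : ℝ) : ℂ) ^ (-betaMu D 6) * (Real.log (y / n) : ℂ)) -
          deriv χ.LFunction 1 * PiW χ d r * frakgW c' D j 6 y‖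
        ≤ C₈₄ * (Real.log D ^ 6)⁻¹ * (∏ q ∈ (d * r).primeFactors, (1 - (q : ℝ)⁻¹)⁻¹) ^ 2)
    (hΞ : ∀ y : ℝ, 1 ≤ y → y ≤ Real.exp (2 * Real.log D ^ (11 / 10 : ℝ) / Real.log D ^ 9 * Real.log D ^ 9) →
      ∑ n ∈ Finset.Ico 1 ⌈y⌉₊, ‖xiZero c' D j n d r‖ / n ≤ Ξ) :
    ‖psiSum c' D χ j u (d * r) * antiSum c' D χ j u d r
        - psiMain c' D χ j u u' (d * r) * antiMain c' D χ j u u' θ (d, r)‖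
      ≤ ((Real.log D ^ 9) ^ 2)⁻¹ *
          ((∏ q ∈ (d * r).primeFactors, (1 - (q : ℝ)⁻¹)⁻¹) ^ 2 * (1 + ‖PiW χ d r‖)) *
          errGood c' D j B₀ B₁ B₂ C₈₄ Ξ ‖deriv χ.LFunction 1‖ θ := by
  set Λ : ℝ := Real.log D ^ 9 with hΛ
  set t : ℕ := d * r with htdef
  have hℓ0 : 0 < Real.log D := by linarith
  have hℓ1 : 1 ≤ Real.log D := by linarith
  have hΛ0 : 0 < Λ := by positivity
  have hL1pos : 0 < Real.log D ^ (11 / 10 : ℝ) := Real.rpow_pos_of_pos hℓ0 _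
  have ht : 1 ≤ t := Nat.one_le_iff_ne_zero.mpr (Nat.mul_ne_zero (by omega) (by omega))
  have ht0 : (0 : ℝ) < t := by exact_mod_cast ht
  -- `τ₁ ≤ Z_t` from `t ≤ e^{(θ−τ₁)Λ}`
  have hZτ : 2 * Real.log D ^ (11 / 10 : ℝ) / Λ ≤ θ - Real.log (t : ℝ) / Λ := by
    have : Real.log (t : ℝ) ≤ (θ - 2 * Real.log D ^ (11 / 10 : ℝ) / Λ) * Λ := by
      rw [← Real.log_exp ((θ - _) * Λ)]; exact Real.log_le_log ht0 hnY
    have : Real.log (t : ℝ) / Λ ≤ θ - 2 * Real.log D ^ (11 / 10 : ℝ) / Λ := by rw [div_le_iff₀ hΛ0]; exact this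
    linarith
  have hZτ' : Real.log D ^ (11 / 10 : ℝ) / Λ ≤ θ - Real.log (t : ℝ) / Λ := by
    have : Real.log D ^ (11 / 10 : ℝ) / Λ ≤ 2 * Real.log D ^ (11 / 10 : ℝ) / Λ := by
      rw [div_le_div_iff_of_pos_right hΛ0]; linarith
    exact this.trans hZτ
  have hz : Real.log (t : ℝ) / Λ ∈ Icc 0 θ := by
    refine ⟨div_nonneg (Real.log_nonneg (by exact_mod_cast ht)) hΛ0.le, ?_⟩
    have : 0 ≤ 2 * Real.log D ^ (11 / 10 : ℝ) / Λ := by positivity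
    linarith
  -- the four inputs of `pointwise_good`
  have hM : ‖psiSum c' D χ j u t - psiMain c' D χ j u u' t‖
      ≤ Λ⁻¹ * deltaM0 c' D j B₀ B₁ B₂ ‖deriv χ.LFunction 1‖ := by
    have h := psi_main_bound χ c' j hprim hL hA hθ1.le hu hu' hu'' hd hd' hvan hB00 hB10 hB20 hB0 hB1 hB2 ht hZτ' hθN
    unfold psiMain
    rw [sub_neg_eq_add]
    exact h
  have hN : ‖antiSum c' D χ j u d r - antiMain c' D χ j u u' θ (d, r)‖
      ≤ Λ⁻¹ * (((∏ q ∈ (d * r).primeFactors, (1 - (q : ℝ)⁻¹)⁻¹) ^ 2 * (1 + ‖PiW χ d r‖)) *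
          deltaN0 c' D j B₀ B₁ B₂ C₈₄ Ξ ‖deriv χ.LFunction 1‖) := by
    have h := anti_main_bound χ hq c' j d r hL hθ1 hu hu' hu'' hd hd' hvan hB00 hB10 hB20 hB0 hB1 hB2 ht hZτ hθN h84 hΞ
    unfold antiMain
    rw [← mul_assoc]
    exact h
  have hAm : ‖psiMain c' D χ j u u' t‖ ≤ Λ⁻¹ * (‖deriv χ.LFunction 1‖ * psiJ0 c' D j B₀ B₁) := by
    unfold psiMain
    rw [norm_neg]
    exact norm_psiMain_le χ c' j hB0 hB1 hz hℓ0 t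
  have hBm : ‖antiMain c' D χ j u u' θ (d, r)‖
      ≤ Λ⁻¹ * (‖deriv χ.LFunction 1‖ * ‖PiW χ d r‖ * antiK0 c' D j B₀ B₁ θ) := by
    unfold antiMain antiK0
    exact norm_antiMain_le χ d r hB0 hB1 hz hℓ0 t
  -- nonnegativity of the constants
  have hC820 : 0 ≤ Lemma82.C82 0 := by
    unfold Lemma82.C82
    have : 0 ≤ Lemma82.I0 := Lemma82.I0_nonneg
    positivity
  have hδM0 : 0 ≤ deltaM0 c' D j B₀ B₁ B₂ ‖deriv χ.LFunction 1‖ := by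
    unfold deltaM0; positivity
  have hK0 : 0 ≤ antiK0 c' D j B₀ B₁ θ := by unfold antiK0; positivity
  have hrel1 : 1 ≤ (∏ q ∈ (d * r).primeFactors, (1 - (q : ℝ)⁻¹)⁻¹) ^ 2 :=
    Section8FrontEnd44ReductionRel.one_le_relFac (d * r)
  have hPR : ‖PiW χ d r‖ ≤ (∏ q ∈ (d * r).primeFactors, (1 - (q : ℝ)⁻¹)⁻¹) ^ 2 * (1 + ‖PiW χ d r‖) := by
    have h0 : 0 ≤ ‖PiW χ d r‖ := norm_nonneg _
    nlinarith
  have key := pointwise_good (M := psiSum c' D χ j u t) (N := antiSum c' D χ j u d r)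
    (A := psiMain c' D χ j u u' t) (B := antiMain c' D χ j u u' θ (d, r)) hΛ0 hPR hδM0 (norm_nonneg _) hK0
    hM hN hAm hBm
  unfold errGood
  exact key

/-- **THE GOOD RANGE:** with `Y = e^{(θ−τ₁)Λ} ≥ 1` and the hypotheses of `good_term_le` for every `(d,r)` with `dr < Y`
(Lemma 8.4's content `h84` and the log-mean bound `hΞ`), the «simple approximation» costs
`‖Σ_{n<⌈Y⌉} Σ_{dr=n} w_j(d,r)(M_j(n)N_j(d,r) − A_j(n)B_j(d,r))‖ ≤ 2e⁴³⁰·Λ⁻²·ERR·(1 + log Y)`.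
[cite: Zhang2022LandauSiegel, §8 display before (8.10), p.47] -/
theorem good_range_bound (c' : ℝ) {D : ℕ} [NeZero D] (χ : DirichletCharacter ℂ D) (hq : χ.IsQuadratic)
    (hprim : χ.IsPrimitive) (j : ℕ) (hL : 3 ≤ Real.log D) (hA : ‖χ.LFunction 1‖ ≤ 1 / Real.log D ^ 2022)
    {u u' u'' : ℝ → ℂ} {θ : ℝ} (hθ0 : 0 ≤ θ) (hθ1 : θ < 1)
    (hu : ContinuousOn u (Icc 0 θ)) (hu' : ContinuousOn u' (Icc 0 θ)) (hu'' : ContinuousOn u'' (Icc 0 θ))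
    (hd : ∀ y ∈ Ioo 0 θ, HasDerivWithinAt u (u' y) (Ioi y) y)
    (hd' : ∀ y ∈ Ioo 0 θ, HasDerivWithinAt u' (u'' y) (Ioi y) y) (hvan : ∀ y : ℝ, θ ≤ y → u y = 0)
    {B₀ B₁ B₂ : ℝ} (hB00 : 0 ≤ B₀) (hB10 : 0 ≤ B₁) (hB20 : 0 ≤ B₂)
    (hB0 : ∀ y ∈ Icc 0 θ, ‖u y‖ ≤ B₀) (hB1 : ∀ y ∈ Icc 0 θ, ‖u' y‖ ≤ B₁)
    (hB2 : ∀ y ∈ Icc 0 θ, ‖u'' y‖ ≤ B₂) (hθN : Real.exp (θ * Real.log D ^ 9) < Nsupp D)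
    (hY1 : 1 ≤ Real.exp ((θ - 2 * Real.log D ^ (11 / 10 : ℝ) / Real.log D ^ 9) * Real.log D ^ 9))
    {C₈₄ Ξ : ℝ} (hC84 : 0 ≤ C₈₄) (hΞ0 : 0 ≤ Ξ)
    (h84 : ∀ d r : ℕ, 1 ≤ d → 1 ≤ r →
      ((d * r : ℕ) : ℝ) < Real.exp ((θ - 2 * Real.log D ^ (11 / 10 : ℝ) / Real.log D ^ 9) * Real.log D ^ 9) →
      ∀ y : ℝ, bigT D < y → y < bigP D →
        ‖(∑ n ∈ Finset.Ico 1 ⌈y⌉₊, χ (n : ZMod D) * xiZero c' D j n d r / (n : ℂ) *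
              ((y / n : ℝ) : ℂ) ^ (-betaMu D 6) * (Real.log (y / n) : ℂ)) -
            deriv χ.LFunction 1 * PiW χ d r * frakgW c' D j 6 y‖
          ≤ C₈₄ * (Real.log D ^ 6)⁻¹ * (∏ q ∈ (d * r).primeFactors, (1 - (q : ℝ)⁻¹)⁻¹) ^ 2)
    (hΞ : ∀ d r : ℕ, 1 ≤ d → 1 ≤ r →
      ((d * r : ℕ) : ℝ) < Real.exp ((θ - 2 * Real.log D ^ (11 / 10 : ℝ) / Real.log D ^ 9) * Real.log D ^ 9) →
      ∀ y : ℝ, 1 ≤ y → y ≤ Real.exp (2 * Real.log D ^ (11 / 10 : ℝ) / Real.log D ^ 9 * Real.log D ^ 9) →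
        ∑ n ∈ Finset.Ico 1 ⌈y⌉₊, ‖xiZero c' D j n d r‖ / n ≤ Ξ) :
    ‖(∑ n ∈ Finset.Ico 1 ⌈Real.exp ((θ - 2 * Real.log D ^ (11 / 10 : ℝ) / Real.log D ^ 9) * Real.log D ^ 9)⌉₊,
          ∑ p ∈ Nat.divisorsAntidiagonal n, sjWeight c' χ j p * (psiSum c' D χ j u n * antiSum c' D χ j u p.1 p.2))
        - ∑ n ∈ Finset.Ico 1 ⌈Real.exp ((θ - 2 * Real.log D ^ (11 / 10 : ℝ) / Real.log D ^ 9) * Real.log D ^ 9)⌉₊,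
          ∑ p ∈ Nat.divisorsAntidiagonal n,
            sjWeight c' χ j p * (psiMain c' D χ j u u' n * antiMain c' D χ j u u' θ p)‖
      ≤ 2 * Real.exp 430 *
          (((Real.log D ^ 9) ^ 2)⁻¹ * errGood c' D j B₀ B₁ B₂ C₈₄ Ξ ‖deriv χ.LFunction 1‖ θ)
          * (1 + Real.log (Real.exp ((θ - 2 * Real.log D ^ (11 / 10 : ℝ) / Real.log D ^ 9) * Real.log D ^ 9))) := by
  set Y : ℝ := Real.exp ((θ - 2 * Real.log D ^ (11 / 10 : ℝ) / Real.log D ^ 9) * Real.log D ^ 9) with hY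
  have hℓ0 : 0 < Real.log D := by linarith
  -- nonnegativity of `ERR`
  have hC820 : 0 ≤ Lemma82.C82 0 := by
    unfold Lemma82.C82
    have : 0 ≤ Lemma82.I0 := Lemma82.I0_nonneg
    positivity
  have hL1pos : 0 < Real.log D ^ (11 / 10 : ℝ) := Real.rpow_pos_of_pos hℓ0 _
  have hE : 0 ≤ ((Real.log D ^ 9) ^ 2)⁻¹ * errGood c' D j B₀ B₁ B₂ C₈₄ Ξ ‖deriv χ.LFunction 1‖ θ := by
    unfold errGood deltaM0 deltaN0 antiK0 psiJ0
    positivity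
  have key := norm_sum_sum_sjWeight_mul_le c' χ j le_rfl hY1 hE
    (fun p => psiSum c' D χ j u (p.1 * p.2) * antiSum c' D χ j u p.1 p.2
      - psiMain c' D χ j u u' (p.1 * p.2) * antiMain c' D χ j u u' θ p) ?_
  · rw [Nat.ceil_one, div_one] at key
    have hre : (∑ n ∈ Finset.Ico 1 ⌈Y⌉₊, ∑ p ∈ Nat.divisorsAntidiagonal n,
          sjWeight c' χ j p * (psiSum c' D χ j u n * antiSum c' D χ j u p.1 p.2))
        - ∑ n ∈ Finset.Ico 1 ⌈Y⌉₊, ∑ p ∈ Nat.divisorsAntidiagonal n,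
          sjWeight c' χ j p * (psiMain c' D χ j u u' n * antiMain c' D χ j u u' θ p)
        = ∑ n ∈ Finset.Ico 1 ⌈Y⌉₊, ∑ p ∈ Nat.divisorsAntidiagonal n,
          sjWeight c' χ j p * (psiSum c' D χ j u (p.1 * p.2) * antiSum c' D χ j u p.1 p.2
            - psiMain c' D χ j u u' (p.1 * p.2) * antiMain c' D χ j u u' θ p) := by
      rw [← Finset.sum_sub_distrib]
      refine Finset.sum_congr rfl fun n _ => ?_
      rw [← Finset.sum_sub_distrib]
      refine Finset.sum_congr rfl fun p hp => ?_
      rw [Nat.mem_divisorsAntidiagonal] at hp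
      rw [hp.1]; ring
    rw [hre]
    exact key
  · rintro n hn ⟨d, r⟩ hp
    rw [Nat.ceil_one, Finset.mem_Ico] at hn
    rw [Nat.mem_divisorsAntidiagonal] at hp
    obtain ⟨hpn, hn0⟩ := hp
    subst hpn
    have hp1 : 1 ≤ d := Nat.one_le_iff_ne_zero.mpr fun h => hn0 (by rw [h, zero_mul])
    have hp2 : 1 ≤ r := Nat.one_le_iff_ne_zero.mpr fun h => hn0 (by rw [h, mul_zero])
    have hnY : ((d * r : ℕ) : ℝ) < Y := Nat.lt_ceil.mp hn.2
    have h := good_term_le χ hq hprim c' j hL hA hθ0 hθ1 hu hu' hu'' hd hd' hvan hB00 hB10 hB20 hB0 hB1 hB2 hθN hp1 hp2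
      hnY.le (h84 d r hp1 hp2 hnY) (hΞ d r hp1 hp2 hnY)
    calc _ ≤ _ := h
      _ = _ := by ring

end Literature.NumberTheory.LFunctions.Zhang2022.DipoleRule

end
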